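import Literature.Geometry.Lorentzian.AFEndPatch
import Literature.Geometry.Lorentzian.AFEndChartPullback
import Literature.Geometry.Lorentzian.AFEndTransplantCoeff
import Literature.Geometry.Lorentzian.AFEndBreathing
import Literature.Geometry.Lorentzian.InitialDataLocality
import Literature.Geometry.Lorentzian.InitialDataDilation
import Literature.Geometry.Lorentzian.AsymptoticallyFlatCompleteness
import Literature.Geometry.Lorentzian.FinalState
import Literature.Geometry.Manifold.BilinFamilyPullback
import Literature.Geometry.Manifold.ModelSpaceBilinSection
import HarnessLib

/-!
# Patching an exact-Schwarzschild end with a collar datum on `ℝ³` across an isotropic annulus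

Explicit construction plus proofs (topic `Geometry/Lorentzian`). Let `e` be an asymptotically flat
end of the `3`-manifold `X` and `C = (h_C, k_C)` an initial data set on `ℝ³`.

* `AFEnd.outerField e H` — the field `coord^* H` on `TX`, the pullback along the coordinate
  function of a field `H` of bilinear forms on `ℝ³` (on the end; junk elsewhere): symmetric /
  positive if `H` is (`dcoord` is injective on the end), depending on `H` only through its value at
  `coord x` (`outerField_congr`), equal to the sections of a datum `D` wherever `H` equals the
  chart components of `D` (`outerField_eq_h_inner`, `outerField_eq_k`), and JOINTLY SMOOTH in a
  parameter when `H` is (`contMDiffAt_outerField_family`, from `BilinFamilyPullback.lean`);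
* `AFEnd.annulusPatchData` — if `D` is, in the chart of `e`, exact time-symmetric isotropic
  Schwarzschild(`M₀`) beyond radius `ρ` (`hCoeff = (1 + M₀/2r)⁴δ`, `kCoeff = 0`) and `C` is the
  same metric on the annulus `{l < ‖y‖ < 2l}` (`l ≥ ρ ≥ R`), then the outer fields
  `(coord^* h_C, coord^* k_C)` are patch data for `D` with radii `(5l/4, 7l/4)`; the patched datum
  is `AFEnd.annulusPatch`: `= D` off `e.far (5l/4)`, `= coord^* C` on it;
* `isVacuumConstraintSolution_annulusPatch` — **the patch of vacuum data by a vacuum collar is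
  vacuum** (locality of the constraints, `InitialDataLocality.lean`: near a point off the closed
  far set it is `D`; on the far region its restriction IS the pullback of `C` along the local
  diffeomorphism `coord`);
* `annulusPatch_mem_admissibleVacuumData` — **and admissible** when `D`, `C` are and `e` is the
  sole end of `X`: its end is the transplanted (`λ = 1`) far end of `C` (`AFEndTransplant.lean`),
  along which it has the Dafermos–Rodnianski decay of `C` (`AFEndTransplantCoeff.lean`), and it is
  complete because one-ended asymptotically flat data are (`isComplete_of_isSoleEnd_holds`).

This is the "insert the universal collar at the end" step of far-field gluing constructions
(Corvino 2000, §4; Bartnik 1986, §1), isolated from all analysis.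

## References

* J. Corvino, *Scalar curvature deformation and a gluing construction for the Einstein
  constraint equations*, Comm. Math. Phys. 214 (2000), §4. [Corvino2000]
* R. Bartnik, *The mass of an asymptotically flat manifold*, CPAM 39 (1986), §1. [Bartnik1986]
* R. Bartnik, J. Isenberg, *The constraint equations* (2004), §2. [BartnikIsenberg2004]
-/

noncomputable section

open Bundle Set Filter TopologicalSpace Function Metric
open scoped Manifold ContDiff Topology
open Literature.Geometry.Manifold

namespace Literature.Geometry.Lorentzian

namespace AFEnd

variable {X : Type} [TopologicalSpace X] [ChartedSpace E3 X] (e : AFEnd X)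

/-! ### The outer fields `coord^* H` -/

/-- **The outer field** `coord^* H`: the pullback along the coordinate function of the end of a
field `H` of bilinear forms on `ℝ³`. [cite: ONeill1983, Ch. 3, Def. 3.9] -/
def outerField (e : AFEnd X) (H : E3 → E3 →L[ℝ] E3 →L[ℝ] ℝ) : BilinField X :=
  fun x ↦ pullbackBilin (I := 𝓘(ℝ, E3)) (I' := 𝓡 3) e.coord
    (show Π z : E3, TangentSpace 𝓘(ℝ, E3) z →L[ℝ] TangentSpace 𝓘(ℝ, E3) z →L[ℝ] ℝ from H) x

/-- `(coord^* H)_x (v, w) = H (coord x) (dcoord v, dcoord w)`. [cite: ONeill1983, Ch. 3, Def. 3.9] -/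
theorem outerField_apply (H : E3 → E3 →L[ℝ] E3 →L[ℝ] ℝ) (x : X) (v w : TangentSpace (𝓡 3) x) :
    outerField e H x v w = H (e.coord x) (mfderiv (𝓡 3) 𝓘(ℝ, E3) e.coord x v)
      (mfderiv (𝓡 3) 𝓘(ℝ, E3) e.coord x w) := rfl

/-- The outer field at `x` depends on `H` only through `H (coord x)`. [folklore] -/
theorem outerField_congr {H H' : E3 → E3 →L[ℝ] E3 →L[ℝ] ℝ} {x : X} (h : H (e.coord x) = H' (e.coord x)) :
    outerField e H x = outerField e H' x := by
  ext v w
  rw [outerField_apply, outerField_apply, h]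

/-- The outer field of a symmetric field is symmetric. [folklore] -/
theorem outerField_symm {H : E3 → E3 →L[ℝ] E3 →L[ℝ] ℝ} (hH : ∀ z v w, H z v w = H z w v) (x : X)
    (v w : TangentSpace (𝓡 3) x) : outerField e H x v w = outerField e H x w v := by
  rw [outerField_apply, outerField_apply, hH]

variable [IsManifold (𝓡 3) ∞ X]

omit [IsManifold (𝓡 3) ∞ X] in
/-- **The outer field of a positive definite field is positive definite on the end** (`dcoord` is
injective there). [folklore] -/
theorem outerField_pos {H : E3 → E3 →L[ℝ] E3 →L[ℝ] ℝ} (hH : ∀ z v, v ≠ 0 → 0 < H z v v) {x : X}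
    (hx : x ∈ e.U) (v : TangentSpace (𝓡 3) x) (hv : v ≠ 0) : 0 < outerField e H x v v := by
  rw [outerField_apply]
  refine hH _ _ fun h0 ↦ hv ?_
  exact e.injective_mfderiv_coord hx (h0.trans (map_zero _).symm)

/-- **The outer field of the chart components of `h_D` is `h_D`** on the end: if
`H (coord x) = hCoeff e D (coord x)` then `(coord^* H)_x = (h_D)_x`. [cite: Bartnik1986, (1.3)] -/
theorem outerField_eq_h_inner (D : InitialDataSet (𝓡 3) X) {H : E3 → E3 →L[ℝ] E3 →L[ℝ] ℝ} {x : X}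
    (hx : x ∈ e.U) (h : H (e.coord x) = hCoeff e D (e.coord x)) : outerField e H x = D.h.inner x := by
  rw [e.outerField_congr h, h_inner_eq_pullbackBilin_coord D hx]
  rfl

/-- **The outer field of the chart components of `k_D` is `k_D`** on the end. [cite: ChristodoulouKlainerman1993, (1.0.9)] -/
theorem outerField_eq_k (D : InitialDataSet (𝓡 3) X) {H : E3 → E3 →L[ℝ] E3 →L[ℝ] ℝ} {x : X}
    (hx : x ∈ e.U) (h : H (e.coord x) = kCoeff e D (e.coord x)) : outerField e H x = D.k x := by
  rw [e.outerField_congr h, k_eq_pullbackBilin_coord D hx]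
  rfl

/-- **Joint smoothness of outer fields of smooth families**: if `(p, z) ↦ c p z` is smooth at
`(p₀, coord x₀)` (`x₀` on the end), then `(p, x) ↦ (coord^*(c p))_x` is jointly smooth at
`(p₀, x₀)` as a map into the bundle of bilinear forms on `TX`. [cite: ONeill1983, Ch. 3, Def. 3.9 and Lemma 3.35] -/
theorem contMDiffAt_outerField_family {EP : Type*} [NormedAddCommGroup EP] [NormedSpace ℝ EP]
    {HP : Type*} [TopologicalSpace HP] {IP : ModelWithCorners ℝ EP HP} {P : Type*} [TopologicalSpace P]
    [ChartedSpace HP P] {c : P → E3 → E3 →L[ℝ] E3 →L[ℝ] ℝ} {p₀ : P} {x₀ : X} (hx₀ : x₀ ∈ e.U)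
    (hc : ContMDiffAt (IP.prod 𝓘(ℝ, E3)) 𝓘(ℝ, E3 →L[ℝ] E3 →L[ℝ] ℝ) ∞ (uncurry c) (p₀, e.coord x₀)) :
    ContMDiffAt (IP.prod (𝓡 3)) ((𝓡 3).prod 𝓘(ℝ, E3 →L[ℝ] E3 →L[ℝ] ℝ)) ∞
      (fun q : P × X ↦ TotalSpace.mk' (E3 →L[ℝ] E3 →L[ℝ] ℝ)
        (E := fun x : X ↦ TangentSpace (𝓡 3) x →L[ℝ] TangentSpace (𝓡 3) x →L[ℝ] ℝ) q.2
        (outerField e (c q.1) q.2)) (p₀, x₀) :=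
  contMDiffAt_pullbackBilin_family (IP := IP) (I' := 𝓡 3) (n := ∞) (e.contMDiffAt_coord hx₀) hc

/-- **Outer fields of smooth fields are smooth on the end.** [cite: ONeill1983, Ch. 3, Lemma 3.35] -/
theorem smoothBilinOn_outerField {H : E3 → E3 →L[ℝ] E3 →L[ℝ] ℝ} (hH : ContDiff ℝ ∞ H) {W : Set X}
    (hW : W ⊆ e.U) : SmoothBilinOn (outerField e H) W := by
  intro x hx
  have hc : ContMDiffAt (𝓘(ℝ, ℝ).prod 𝓘(ℝ, E3)) 𝓘(ℝ, E3 →L[ℝ] E3 →L[ℝ] ℝ) ∞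
      (uncurry fun (_ : ℝ) (z : E3) ↦ H z) ((0 : ℝ), e.coord x) :=
    hH.contMDiff.contMDiffAt.comp _ contMDiffAt_snd
  have h := e.contMDiffAt_outerField_family (IP := 𝓘(ℝ, ℝ)) (c := fun (_ : ℝ) (z : E3) ↦ H z) (hW hx) hc
  have h2 : ContMDiffAt (𝓡 3) (𝓘(ℝ, ℝ).prod (𝓡 3)) ∞ (fun y : X ↦ ((0 : ℝ), y)) x :=
    contMDiffAt_const.prodMk contMDiffAt_id
  exact (h.comp x h2).contMDiffWithinAt

/-! ### Patch data across an isotropic Schwarzschild annulus -/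

variable {e} {D : InitialDataSet (𝓡 3) X} {C : InitialDataSet (𝓡 3) E3} {ρ l M₀ : ℝ}

/-- **The hypotheses of the annulus patch**: `R ≤ ρ ≤ l`, `0 < l`; `D` is exact isotropic
Schwarzschild(`M₀`) beyond `ρ` in the chart of `e`; `C` is the same on the annulus `{l < ‖y‖ < 2l}`.
[cite: Corvino2000, §4] -/
structure AnnulusPatchData (e : AFEnd X) (D : InitialDataSet (𝓡 3) X) (C : InitialDataSet (𝓡 3) E3)
    (ρ l M₀ : ℝ) : Prop where
  R_le : e.R ≤ ρ
  le_l : ρ ≤ l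
  l_pos : 0 < l
  exactD : ∀ y : E3, ρ < ‖y‖ →
    hCoeff e D y = (1 + M₀ / (2 * ‖y‖)) ^ 4 • (innerSL ℝ : E3 →L[ℝ] E3 →L[ℝ] ℝ) ∧ kCoeff e D y = 0
  exactC : ∀ y : E3, l < ‖y‖ → ‖y‖ < 2 * l →
    C.h.inner y = (1 + M₀ / (2 * ‖y‖)) ^ 4 • (innerSL ℝ : E3 →L[ℝ] E3 →L[ℝ] ℝ) ∧ C.k y = 0

variable (A : AnnulusPatchData e D C ρ l M₀)

include A in
/-- On the agreement annulus the outer metric is the metric of `D`. [cite: Corvino2000, §4] -/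
theorem outerField_coordH_eq {x : X} (hx : x ∈ e.far (5 / 4 * l)) (hlt : ‖e.coord x‖ < 7 / 4 * l) :
    outerField e C.coordH x = D.h.inner x := by
  obtain ⟨hxU, hgt⟩ := e.mem_far_iff_coord.1 hx
  refine e.outerField_eq_h_inner D hxU ?_
  have h1 : l < ‖e.coord x‖ := by linarith [A.l_pos]
  have h2 : ‖e.coord x‖ < 2 * l := by linarith [A.l_pos]
  have h3 : ρ < ‖e.coord x‖ := lt_of_le_of_lt A.le_l h1
  rw [InitialDataSet.coordH, (A.exactC _ h1 h2).1, (A.exactD _ h3).1]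
  rfl

include A in
/-- On the agreement annulus the outer `k` is `k_D` (both vanish). [cite: Corvino2000, §4] -/
theorem outerField_coordK_eq {x : X} (hx : x ∈ e.far (5 / 4 * l)) (hlt : ‖e.coord x‖ < 7 / 4 * l) :
    outerField e C.coordK x = D.k x := by
  obtain ⟨hxU, hgt⟩ := e.mem_far_iff_coord.1 hx
  refine e.outerField_eq_k D hxU ?_
  have h1 : l < ‖e.coord x‖ := by linarith [A.l_pos]
  have h2 : ‖e.coord x‖ < 2 * l := by linarith [A.l_pos]
  have h3 : ρ < ‖e.coord x‖ := lt_of_le_of_lt A.le_l h1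
  rw [InitialDataSet.coordK, (A.exactC _ h1 h2).2, (A.exactD _ h3).2]
  rfl

/-- **The annulus patch data**: the outer fields `(coord^* h_C, coord^* k_C)` patch `D` with radii
`(5l/4, 7l/4)`. [cite: Corvino2000, §4] -/
theorem annulusPatchData (A : AnnulusPatchData e D C ρ l M₀) :
    e.PatchData D (5 / 4 * l) (7 / 4 * l) (outerField e C.coordH) (outerField e C.coordK) where
  R_le := by linarith [A.R_le, A.le_l, A.l_pos]
  lt := by linarith [A.l_pos]
  smooth_h := e.smoothBilinOn_outerField C.contMDiff_coordH.contDiff (e.far_subset _)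
  smooth_k := e.smoothBilinOn_outerField C.contMDiff_coordK.contDiff (e.far_subset _)
  symm_h x _ v w := e.outerField_symm (fun z v w ↦ C.h.symm z v w) x v w
  pos_h x hx v hv := e.outerField_pos (fun z v hv ↦ C.h.pos z v hv) (e.far_subset _ hx) v hv
  symm_k x _ v w := e.outerField_symm (fun z v w ↦ C.k_symm z v w) x v w
  agree_h x hx hlt := outerField_coordH_eq A hx hlt
  agree_k x hx hlt := outerField_coordK_eq A hx hlt

/-- **The annulus patch** `D ⋈ C`: `D` off `e.far (5l/4)`, `coord^* C` on it (an `abbrev` of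
`AFEnd.patch`, so that instances about the patch are found). [cite: Corvino2000, §4] -/
abbrev annulusPatch (A : AnnulusPatchData e D C ρ l M₀) : InitialDataSet (𝓡 3) X :=
  e.patch D (annulusPatchData A)

/-- Off `far (5l/4)` the patch is `D`. [cite: Corvino2000, §4] -/
theorem annulusPatch_eq_of_not_mem_far {x : X} (hx : x ∉ e.far (5 / 4 * l)) :
    (annulusPatch A).h.inner x = D.h.inner x ∧ (annulusPatch A).k x = D.k x :=
  patch_eq_of_not_mem_far (annulusPatchData A) hx

/-- On `far (5l/4)` the patch is `coord^* C`. [cite: Corvino2000, §4] -/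
theorem annulusPatch_eq_of_mem_far {x : X} (hx : x ∈ e.far (5 / 4 * l)) :
    (annulusPatch A).h.inner x = outerField e C.coordH x ∧ (annulusPatch A).k x = outerField e C.coordK x :=
  ⟨patch_h_inner_of_mem (annulusPatchData A) hx, patch_k_of_mem (annulusPatchData A) hx⟩

/-! ### The patch of vacuum data by a vacuum collar is vacuum -/

omit [IsManifold (𝓡 3) ∞ X] in
/-- `coord` on the far region `far R₁`, as a map from the open submanifold. [folklore] -/
theorem contMDiff_coord_comp_val (R₁ : ℝ) :
    ContMDiff (𝓡 3) 𝓘(ℝ, E3) (∞ + 1) (e.coord ∘ (Subtype.val : e.farOpens R₁ → X)) := fun u ↦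
  (e.contMDiffAt_coord (e.far_subset R₁ u.2)).comp u contMDiff_subtype_val.contMDiffAt

omit [IsManifold (𝓡 3) ∞ X] in
/-- The differentials of `coord` on the far region are injective. [folklore] -/
theorem injective_mfderiv_coord_comp_val (R₁ : ℝ) (u : e.farOpens R₁) :
    Injective (mfderiv (𝓡 3) 𝓘(ℝ, E3) (e.coord ∘ (Subtype.val : e.farOpens R₁ → X)) u) := by
  have hc : MDifferentiableAt (𝓡 3) 𝓘(ℝ, E3) e.coord (u : X) :=
    (e.contMDiffAt_coord (e.far_subset R₁ u.2)).mdifferentiableAt (by simp)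
  have hv : MDifferentiableAt (𝓡 3) (𝓡 3) (Subtype.val : e.farOpens R₁ → X) u :=
    (contMDiff_subtype_val (n := ∞)).mdifferentiableAt (by simp)
  rw [mfderiv_comp u hc hv]
  exact (e.injective_mfderiv_coord (e.far_subset R₁ u.2)).comp (InitialDataSet.injective_mfderiv_subtypeVal _ u)

/-- **On the far region, the restriction of the patch IS the pullback of `C` along `coord`.**
[cite: BartnikIsenberg2004, §2] -/
theorem annulusPatch_comap_val_eq :
    (annulusPatch A).comap (Subtype.val : e.farOpens (5 / 4 * l) → X)
        (InitialDataSet.contMDiff_subtypeVal_succ _) (InitialDataSet.injective_mfderiv_subtypeVal _) =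
      C.comap (e.coord ∘ (Subtype.val : e.farOpens (5 / 4 * l) → X)) (contMDiff_coord_comp_val (5 / 4 * l))
        (injective_mfderiv_coord_comp_val (5 / 4 * l)) := by
  have hchain : ∀ (u : e.farOpens (5 / 4 * l)) (v : TangentSpace (𝓡 3) u),
      mfderiv (𝓡 3) 𝓘(ℝ, E3) (e.coord ∘ (Subtype.val : e.farOpens (5 / 4 * l) → X)) u v =
        mfderiv (𝓡 3) 𝓘(ℝ, E3) e.coord (u : X)
          (mfderiv (𝓡 3) (𝓡 3) (Subtype.val : e.farOpens (5 / 4 * l) → X) u v) := by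
    intro u v
    have hc : MDifferentiableAt (𝓡 3) 𝓘(ℝ, E3) e.coord (u : X) :=
      (e.contMDiffAt_coord (e.far_subset _ u.2)).mdifferentiableAt (by simp)
    have hv : MDifferentiableAt (𝓡 3) (𝓡 3) (Subtype.val : e.farOpens (5 / 4 * l) → X) u :=
      (contMDiff_subtype_val (n := ∞)).mdifferentiableAt (by simp)
    rw [mfderiv_comp u hc hv]
    rfl
  refine InitialDataSet.ext' (fun u v w ↦ ?_) (fun u v w ↦ ?_)
  · rw [InitialDataSet.comap_h_inner, InitialDataSet.comap_h_inner, (annulusPatch_eq_of_mem_far A u.2).1,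
      outerField_apply, hchain, hchain]
    rfl
  · rw [InitialDataSet.comap_k, InitialDataSet.comap_k, (annulusPatch_eq_of_mem_far A u.2).2,
      outerField_apply, hchain, hchain]
    rfl

/-- **The annulus patch of vacuum data by a vacuum collar is vacuum.** [cite: BartnikIsenberg2004, §2] -/
theorem isVacuumConstraintSolution_annulusPatch [(annulusPatch A).metric.HasLeviCivita]
    (hD : ∀ [D.metric.HasLeviCivita], D.IsVacuumConstraintSolution)
    (hC : ∀ [C.metric.HasLeviCivita], C.IsVacuumConstraintSolution) :
    (annulusPatch A).IsVacuumConstraintSolution := by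
  haveI : D.metric.HasLeviCivita := D.metric.hasLeviCivita
  haveI : C.metric.HasLeviCivita := C.metric.hasLeviCivita
  intro x
  by_cases hx : x ∈ e.far (5 / 4 * l)
  · -- on the far region: restriction = pullback of `C`
    set V : Opens X := e.farOpens (5 / 4 * l) with hV
    haveI h1 : ((annulusPatch A).comap (Subtype.val : V → X) (InitialDataSet.contMDiff_subtypeVal_succ V)
        (InitialDataSet.injective_mfderiv_subtypeVal V)).metric.HasLeviCivita := PseudoRiemannianMetric.hasLeviCivita _
    haveI h2 : (C.comap (e.coord ∘ (Subtype.val : V → X)) (contMDiff_coord_comp_val (5 / 4 * l))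
        (injective_mfderiv_coord_comp_val (5 / 4 * l))).metric.HasLeviCivita := PseudoRiemannianMetric.hasLeviCivita _
    have hu := (InitialDataSet.isVacuumAt_comap_iff (annulusPatch A) (InitialDataSet.contMDiff_subtypeVal_succ V)
      (InitialDataSet.injective_mfderiv_subtypeVal V) ⟨x, hx⟩).1
    apply hu
    have key : ∀ (A' B' : InitialDataSet (𝓡 3) V) [A'.metric.HasLeviCivita] [B'.metric.HasLeviCivita],
        A' = B' → B'.IsVacuumConstraintSolution →
          (A'.hamiltonianConstraintFn ⟨x, hx⟩ = 0 ∧ A'.momentumConstraintFn ⟨x, hx⟩ = 0) := by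
      rintro A' B' _ _ rfl hB
      exact hB ⟨x, hx⟩
    exact key _ _ (annulusPatch_comap_val_eq A) (C.isVacuumConstraintSolution_comap' _ _ hC)
  · -- off the far region: locally `D`
    have hR' : e.R < 3 / 2 * l := by linarith [A.R_le, A.le_l, A.l_pos]
    have hx' : x ∉ e.closedFar (3 / 2 * l) :=
      e.notMem_closedFar_of_notMem_far (by linarith [A.l_pos]) hx
    obtain ⟨hh, hk⟩ := patch_eventuallyEq_of_not_mem_closedFar (annulusPatchData A) hR'
      (by linarith [A.l_pos]) hx'
    exact (InitialDataSet.isVacuumAt_congr hh hk).2 (hD x)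

/-! ### The end of the patch: the transplanted far end of `C` -/

omit [IsManifold (𝓡 3) ∞ X] in
/-- `Ψ₁ = coord`: the transplant map with scale `1` is the coordinate function. [folklore] -/
theorem transplantMap_one (e : AFEnd X) : e.transplantMap 1 = e.coord := by
  funext x
  rw [e.transplantMap_apply, inv_one, one_smul]

include A in
/-- **Transplant data for the far end of `C`**: for an end `f` of `ℝ³` there are radii
`ρ₁ ≥ f.R`, `ρ₀ > 5l/4` with `f.far ρ₁ ⊆ {ρ₀ ≤ ‖y‖}` (far regions eventually avoid the compact
ball), so that `TransplantData e f 1 ρ₀ ρ₁`. [cite: Bartnik1986, §1] -/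
theorem exists_transplantData (f : AFEnd E3) :
    ∃ ρ₀ ρ₁ : ℝ, 5 / 4 * l < ρ₀ ∧ TransplantData e f 1 ρ₀ ρ₁ := by
  obtain ⟨R₀, hR₀⟩ := f.exists_forall_far_disjoint (isCompact_closedBall (0 : E3) (5 / 4 * l + 1))
  refine ⟨5 / 4 * l + 1, max R₀ f.R, by linarith, one_pos, le_max_right _ _, ?_, fun y hy ↦ ?_⟩
  · rw [one_mul]; linarith [A.R_le, A.le_l, A.l_pos]
  · by_contra h
    rw [not_le] at h
    have hmem : y ∈ closedBall (0 : E3) (5 / 4 * l + 1) := by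
      rw [mem_closedBall, dist_zero_right]; exact h.le
    exact Set.disjoint_left.1 (hR₀ _ (le_max_left _ _)) hy hmem

/-- **The annulus patch is strongly asymptotically flat along the transplanted far end of `C`**,
with the mass of `C`. [cite: DafermosRodnianski2013, App. B.2.3] -/
theorem isStronglyAsymptoticallyFlatDR_annulusPatch {f : AFEnd E3} {ρ₀ ρ₁ : ℝ} (hρ₀ : 5 / 4 * l < ρ₀)
    (T : TransplantData e f 1 ρ₀ ρ₁) {M₁ : ℝ} (hC : f.IsStronglyAsymptoticallyFlatDR C M₁) :
    (transplant T).IsStronglyAsymptoticallyFlatDR (annulusPatch A) M₁ := by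
  have hfar : ∀ x ∈ (transplant T).U, x ∈ e.far (5 / 4 * l) := by
    intro x hx
    obtain ⟨hxU, hΨ⟩ := (mem_transplant_U T).1 hx
    have hn : ρ₀ ≤ ‖e.coord x‖ := by
      have h := T.le_norm _ hΨ
      rwa [transplantMap_one] at h
    exact e.mem_far_iff_coord.2 ⟨hxU, lt_of_lt_of_le hρ₀ hn⟩
  have hSh : ∀ x ∈ (transplant T).U, (annulusPatch A).h.inner x =
      (1 : ℝ) ^ 2 • pullbackBilin (I := 𝓘(ℝ, E3)) (I' := 𝓡 3) (e.transplantMap 1)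
        (show Π y : E3, TangentSpace 𝓘(ℝ, E3) y →L[ℝ] TangentSpace 𝓘(ℝ, E3) y →L[ℝ] ℝ from C.h.inner) x := by
    intro x hx
    rw [one_pow, one_smul, transplantMap_one, (annulusPatch_eq_of_mem_far A (hfar x hx)).1]
    rfl
  have hSk : ∀ x ∈ (transplant T).U, (annulusPatch A).k x =
      (1 : ℝ) • pullbackBilin (I := 𝓘(ℝ, E3)) (I' := 𝓡 3) (e.transplantMap 1)
        (show Π y : E3, TangentSpace 𝓘(ℝ, E3) y →L[ℝ] TangentSpace 𝓘(ℝ, E3) y →L[ℝ] ℝ from C.k) x := by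
    intro x hx
    rw [one_smul, transplantMap_one, (annulusPatch_eq_of_mem_far A (hfar x hx)).2]
    rfl
  have h := IsStronglyAsymptoticallyFlatDR.transplant T C (annulusPatch A) hSh hSk hC
  rwa [one_mul] at h

variable [T2Space X] [SecondCountableTopology X] [ConnectedSpace X]

/-- **The annulus patch of admissible data by an admissible vacuum collar is admissible** (`e` the
sole end of `X`; `D`, `C` vacuum; `C` with a sole Dafermos–Rodnianski end): vacuum by
`isVacuumConstraintSolution_annulusPatch`, the end is the transplanted far end of `C` (sole,
`isSoleEnd_transplant`), completeness by `isComplete_of_isSoleEnd_holds`. [cite: Christodoulou1999, p. A24] -/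
theorem annulusPatch_mem_admissibleVacuumData (he : e.IsSoleEnd)
    (hD : ∀ [D.metric.HasLeviCivita], D.IsVacuumConstraintSolution)
    (hCadm : C ∈ admissibleVacuumData E3) : annulusPatch A ∈ admissibleVacuumData X := by
  obtain ⟨hCvac, f, M₁, hfsole, hfdecay⟩ := hCadm
  obtain ⟨ρ₀, ρ₁, hρ₀, T⟩ := exists_transplantData A f
  have hdecay := isStronglyAsymptoticallyFlatDR_annulusPatch A hρ₀ T hfdecay
  have hsole : (transplant T).IsSoleEnd := isSoleEnd_transplant T he (exists_forall_mem_far_of_isSoleEnd hfsole)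
  refine ⟨?_, transplant T, M₁, hsole, hdecay⟩
  intro inst
  have hCv : ∀ [C.metric.HasLeviCivita], C.IsVacuumConstraintSolution := fun {i} ↦ hCvac.1
  exact ⟨isVacuumConstraintSolution_annulusPatch A hD hCv,
    isComplete_of_isSoleEnd_holds X (annulusPatch A) (transplant T) M₁ 1 2 2 1 zero_le_one hdecay hsole⟩

end AFEnd

end Literature.Geometry.Lorentzian

end
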